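import Summits.RiemannHypothesis.RiemannHypothesis.Theorems.SoloInformedQuasiWeilExact
import Summits.RiemannHypothesis.RiemannHypothesis.Theorems.SoloInformedQuasiWeilStrip
import Summits.RiemannHypothesis.RiemannHypothesis.Theorems.HandoffWallSequence
import Summits.RiemannHypothesis.RiemannHypothesis.Theorems.SoloInformedEffMain
import Summits.RiemannHypothesis.RiemannHypothesis.Theorems.HandoffLadderRungOne
import Literature.NumberTheory.DiophantineGeometry.NamedHypotheses
import Literature.NumberTheory.LFunctions.RiemannHypothesisUpTo101

/-!
# RiemannHypothesis / Splittings — Weil-negativity rungs II: the S9 resolution split priced through effective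
double-log visibility (RAW zero-definition form of cell rh-split, seat (weil, neg) gen 2, card §8 G4)

Raw form (typer-2 g2) of §4 of `HOME/rh-split-weil-neg/SketchG2.lean` (sha16 d7d5117629c732f7; referee replay std);
the Prop `VisibleIsolated H` («every off-line zero is H-visible and H-isolated») is WRITTEN OUT (theorems only).
* `rh_of_finW_visibleIsolated` — `FIN_W(H) ∧ B(H) ⟹ RH` with the FIN conjunct LOAD-BEARING for `H > 1` (tree T20-eff);
* `rh_of_visibleIsolated_of_le_one` — decoration for `H ≤ 1`; `visibleIsolated_of_rh`;
* `rh_of_visibleIsolated_of_upTo` — EXCHANGE RATE window `H` ↔ height `e^{e^{H−1}}`: `B(H)` + RH up to `T` is RH when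
  `e^{e^{H−1}} ≤ T + 2`; `…_of_le_five_halves` (unconditional, height 101, std), `…_of_le_four` (on Platt–Trudgian F1).
Referee label (19:34Z): S9 typed with FIN load-bearing only for `H > 4.358` under F1, `≤ 5/2` unconditionally;
booked with BombieriWindow(H)/X-1; class UNCHANGED barrier note.

SPLITTING SEARCH over kernel-typed RH-EQUIVALENCES; a splitting A ∧ B ⟹ RH is CONDITIONAL bookkeeping unless A and
B are both proved; nothing here bears on the truth of RH.
-/

noncomputable section

set_option linter.dupNamespace false

open Complex Filter Set MeasureTheory
open scoped Real Topology ComplexConjugate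
open Literature.NumberTheory.LFunctions Literature.NumberTheory.LFunctions.WeilConverse
open Summit.RiemannHypothesis.RiemannHypothesis.Theorems
open Summit.RiemannHypothesis.RiemannHypothesis.Theorems.MotivicDoor.SemilocalThreshold (weilSemilocalThreshold)
open Summit.RiemannHypothesis.RiemannHypothesis.Theorems.WeilFormatCData.A1 (weilPositivityOn_one)

namespace Summit.RiemannHypothesis.RiemannHypothesis.Theorems.Splittings.WeilNegRungs


/-! ## §4 S9 typed: the resolution split through effective double-log visibility (tree T20-eff) -/

/-- **S9 typed: `FIN_W(H) ∧ B(H) ⟹ RH`** with the FIN conjunct LOAD-BEARING (a Weil window certificate at `H` kills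
every visible isolated off-line pair, by `riemannZeta_ne_zero_of_local_of_weilGroundEnergy_nonneg_eff`). -/
theorem rh_of_finW_visibleIsolated {H : ℝ} (hH : 1 < H) (hA : WeilPositivityOn H) (hB : (∀ η γ : ℝ, η ≠ 0 → |η| < 1 / 2 → riemannZeta (1 / 2 + η + γ * I) = 0 →
      ∃ R : ℝ, 1 ≤ |γ| ∧
        doubleLogC0 (windowPlateau 1) |η| + Real.log (Real.log (|γ| + 2)) / (2 * |η|) ≤ H - 1 ∧
        1 ≤ R ∧ Real.exp (H - 1 + 1) ≤ R ^ 2 ∧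
        (∀ ρ : ℂ, riemannZeta ρ = 0 → 0 ≤ ρ.re → ρ.re ≤ 1 → |ρ.im - γ| < R → ρ.re ≠ 1 / 2 →
            ρ = 1 / 2 + ↑|η| + γ * I ∨ ρ = 1 / 2 - ↑|η| + γ * I))) :
    _root_.RiemannHypothesis := by
  refine riemannHypothesis_iff_strip_holds.2 fun s hs h0 h1 ↦ ?_
  by_contra hne
  have hs' : (1 / 2 : ℂ) + ((s.re - 1 / 2 : ℝ) : ℂ) + ((s.im : ℝ) : ℂ) * I = s := by
    apply Complex.ext <;> simp
  have hη0 : s.re - 1 / 2 ≠ 0 := sub_ne_zero.2 hne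
  have hη : |s.re - 1 / 2| < 1 / 2 := abs_lt.2 ⟨by linarith, by linarith⟩
  have hz : riemannZeta (1 / 2 + ((s.re - 1 / 2 : ℝ) : ℂ) + ((s.im : ℝ) : ℂ) * I) = 0 := by rw [hs']; exact hs
  obtain ⟨R, hγ1, hc, hR, hRc, hloc⟩ := hB (s.re - 1 / 2) s.im hη0 hη hz
  have hE : 0 ≤ weilGroundEnergy (H - 1 + 1) := by
    rw [sub_add_cancel]
    exact weilGroundEnergy_nonneg_of_weilPositivityOn (by linarith) le_rfl hA
  exact riemannZeta_ne_zero_of_local_of_weilGroundEnergy_nonneg_eff hη0 hη s.im (H - 1) R hγ1 hc hR hRc hloc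
    hE hz

/-- `B(H)` is RH-implied (vacuously: under RH there is no off-line zero). -/
theorem visibleIsolated_of_rh (H : ℝ) (h : _root_.RiemannHypothesis) : (∀ η γ : ℝ, η ≠ 0 → |η| < 1 / 2 → riemannZeta (1 / 2 + η + γ * I) = 0 →
      ∃ R : ℝ, 1 ≤ |γ| ∧
        doubleLogC0 (windowPlateau 1) |η| + Real.log (Real.log (|γ| + 2)) / (2 * |η|) ≤ H - 1 ∧
        1 ≤ R ∧ Real.exp (H - 1 + 1) ≤ R ^ 2 ∧
        (∀ ρ : ℂ, riemannZeta ρ = 0 → 0 ≤ ρ.re → ρ.re ≤ 1 → |ρ.im - γ| < R → ρ.re ≠ 1 / 2 →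
            ρ = 1 / 2 + ↑|η| + γ * I ∨ ρ = 1 / 2 - ↑|η| + γ * I)) := by
  intro η γ hη0 hη hz
  exfalso
  have hre : (1 / 2 + (η : ℂ) + (γ : ℂ) * I).re = 1 / 2 + η := by simp
  have h0 : 0 < (1 / 2 + (η : ℂ) + (γ : ℂ) * I).re := by
    rw [hre]; have := abs_lt.1 hη; linarith
  have h1 : (1 / 2 + (η : ℂ) + (γ : ℂ) * I).re < 1 := by
    rw [hre]; have := abs_lt.1 hη; linarith
  have := riemannHypothesis_iff_strip_holds.1 h _ hz h0 h1
  rw [hre] at this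
  exact hη0 (by linarith)

/-- For `H ≤ 1` the visibility clause is unsatisfiable (`c₀ ≥ 0`, `log log(|γ|+2) > 0`), so `B(H)` alone is RH and the
certified rung `FIN_W(1)` (`weilPositivityOn_one`) is DECORATION there: the split has content only for windows `H > 1`,
none of which is certified today. -/
theorem rh_of_visibleIsolated_of_le_one {H : ℝ} (hH : H ≤ 1) (hB : (∀ η γ : ℝ, η ≠ 0 → |η| < 1 / 2 → riemannZeta (1 / 2 + η + γ * I) = 0 →
      ∃ R : ℝ, 1 ≤ |γ| ∧
        doubleLogC0 (windowPlateau 1) |η| + Real.log (Real.log (|γ| + 2)) / (2 * |η|) ≤ H - 1 ∧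
        1 ≤ R ∧ Real.exp (H - 1 + 1) ≤ R ^ 2 ∧
        (∀ ρ : ℂ, riemannZeta ρ = 0 → 0 ≤ ρ.re → ρ.re ≤ 1 → |ρ.im - γ| < R → ρ.re ≠ 1 / 2 →
            ρ = 1 / 2 + ↑|η| + γ * I ∨ ρ = 1 / 2 - ↑|η| + γ * I))) : _root_.RiemannHypothesis := by
  refine riemannHypothesis_iff_strip_holds.2 fun s hs h0 h1 ↦ ?_
  by_contra hne
  have hs' : (1 / 2 : ℂ) + ((s.re - 1 / 2 : ℝ) : ℂ) + ((s.im : ℝ) : ℂ) * I = s := by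
    apply Complex.ext <;> simp
  have hη0 : s.re - 1 / 2 ≠ 0 := sub_ne_zero.2 hne
  have hη : |s.re - 1 / 2| < 1 / 2 := abs_lt.2 ⟨by linarith, by linarith⟩
  have hz : riemannZeta (1 / 2 + ((s.re - 1 / 2 : ℝ) : ℂ) + ((s.im : ℝ) : ℂ) * I) = 0 := by rw [hs']; exact hs
  obtain ⟨R, hγ1, hc, -, -, -⟩ := hB (s.re - 1 / 2) s.im hη0 hη hz
  have hpos : 0 < |s.re - 1 / 2| := abs_pos.2 hη0
  have hc0 : 0 ≤ doubleLogC0 (windowPlateau 1) |s.re - 1 / 2| :=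
    doubleLogC0_nonneg (windowPlateau_nonneg 1) hpos (bumpLaplace_windowPlateau_one_pos _)
  have hll : 0 < Real.log (Real.log (|s.im| + 2)) := by
    apply Real.log_pos
    have h3 : Real.exp 1 < |s.im| + 2 := by
      have := Real.exp_one_lt_d9; linarith
    have := Real.log_lt_log (Real.exp_pos 1) h3
    rwa [Real.log_exp] at this
  have hq : 0 < Real.log (Real.log (|s.im| + 2)) / (2 * |s.re - 1 / 2|) := by positivity
  linarith

/-- **Below the exchange height, FIN is dominated by numerical RH.** If every zero with `0 < Im s ≤ T` is on the
line and `e^{e^{H−1}} ≤ T + 2`, then `B(H)` ALONE gives RH: an `H`-visible off-line zero has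
`log log(|γ|+2) ≤ (H−1)·2|η| < H − 1`, i.e. `|γ| < e^{e^{H−1}} − 2 ≤ T`, and RH-up-to-`T` (with `riemannZeta_conj` for
`γ < 0`) puts it on the line. Exchange rate: window `H` ↔ height `e^{e^{H−1}}`. -/
theorem rh_of_visibleIsolated_of_upTo {H T : ℝ}
    (hT : Literature.NumberTheory.DiophantineGeometry.RiemannHypothesisUpTo T)
    (hHT : Real.exp (Real.exp (H - 1)) ≤ T + 2) (hB : (∀ η γ : ℝ, η ≠ 0 → |η| < 1 / 2 → riemannZeta (1 / 2 + η + γ * I) = 0 →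
      ∃ R : ℝ, 1 ≤ |γ| ∧
        doubleLogC0 (windowPlateau 1) |η| + Real.log (Real.log (|γ| + 2)) / (2 * |η|) ≤ H - 1 ∧
        1 ≤ R ∧ Real.exp (H - 1 + 1) ≤ R ^ 2 ∧
        (∀ ρ : ℂ, riemannZeta ρ = 0 → 0 ≤ ρ.re → ρ.re ≤ 1 → |ρ.im - γ| < R → ρ.re ≠ 1 / 2 →
            ρ = 1 / 2 + ↑|η| + γ * I ∨ ρ = 1 / 2 - ↑|η| + γ * I))) : _root_.RiemannHypothesis := by
  refine riemannHypothesis_iff_strip_holds.2 fun s hs h0 h1 ↦ ?_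
  by_contra hne
  have hs' : (1 / 2 : ℂ) + ((s.re - 1 / 2 : ℝ) : ℂ) + ((s.im : ℝ) : ℂ) * I = s := by
    apply Complex.ext <;> simp
  have hη0 : s.re - 1 / 2 ≠ 0 := sub_ne_zero.2 hne
  have hη : |s.re - 1 / 2| < 1 / 2 := abs_lt.2 ⟨by linarith, by linarith⟩
  have hz : riemannZeta (1 / 2 + ((s.re - 1 / 2 : ℝ) : ℂ) + ((s.im : ℝ) : ℂ) * I) = 0 := by rw [hs']; exact hs
  obtain ⟨R, hγ1, hc, -, -, -⟩ := hB (s.re - 1 / 2) s.im hη0 hη hz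
  have hpos : 0 < |s.re - 1 / 2| := abs_pos.2 hη0
  have hc0 : 0 ≤ doubleLogC0 (windowPlateau 1) |s.re - 1 / 2| :=
    doubleLogC0_nonneg (windowPlateau_nonneg 1) hpos (bumpLaplace_windowPlateau_one_pos _)
  have h2pos : (0 : ℝ) < |s.im| + 2 := by positivity
  have hlogpos : 0 < Real.log (|s.im| + 2) := Real.log_pos (by linarith [abs_nonneg s.im])
  have hll : 0 < Real.log (Real.log (|s.im| + 2)) := by
    apply Real.log_pos
    have h3 : Real.exp 1 < |s.im| + 2 := by
      have := Real.exp_one_lt_d9; linarith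
    have := Real.log_lt_log (Real.exp_pos 1) h3
    rwa [Real.log_exp] at this
  have h2η : 0 < 2 * |s.re - 1 / 2| := by positivity
  have hq : Real.log (Real.log (|s.im| + 2)) / (2 * |s.re - 1 / 2|) ≤ H - 1 := by linarith
  have hH1 : 0 < H - 1 := lt_of_lt_of_le (div_pos hll h2η) hq
  have hlt : Real.log (Real.log (|s.im| + 2)) < H - 1 := by
    have h1' : Real.log (Real.log (|s.im| + 2)) ≤ (H - 1) * (2 * |s.re - 1 / 2|) := by
      rwa [div_le_iff₀ h2η] at hq
    have h2' : (H - 1) * (2 * |s.re - 1 / 2|) < (H - 1) * 1 :=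
      mul_lt_mul_of_pos_left (by linarith) hH1
    linarith
  have hγT : |s.im| < T := by
    have e1 : Real.log (|s.im| + 2) < Real.exp (H - 1) := by
      rw [← Real.exp_lt_exp, Real.exp_log hlogpos] at hlt
      exact hlt
    have e2 : |s.im| + 2 < Real.exp (Real.exp (H - 1)) := by
      rw [← Real.exp_lt_exp, Real.exp_log h2pos] at e1
      exact e1
    linarith
  rcases lt_trichotomy s.im 0 with hneg | hzero | hpos'
  · have hc' : riemannZeta (conj s) = 0 := by rw [riemannZeta_conj, hs, map_zero]
    have him1 : 0 < (conj s).im := by rw [Complex.conj_im]; linarith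
    have him2 : (conj s).im ≤ T := by
      rw [Complex.conj_im]; rw [abs_of_neg hneg] at hγT; linarith
    have := hT (conj s) hc' him1 him2
    rw [Complex.conj_re] at this
    exact hne this
  · rw [hzero, abs_zero] at hγ1; linarith
  · exact hne (hT s hs hpos' (by rw [abs_of_pos hpos'] at hγT; exact hγT.le))

/-- UNCONDITIONAL instance (PROVED `riemannHypothesisUpTo_hundredOne`, height 101): for every window `H ≤ 5/2`,
`B(H)` alone is RH (`e^{e^{3/2}} = 88.4… ≤ 103`); exact threshold `1 + log log 103 = 2.5335…`. -/
theorem rh_of_visibleIsolated_of_le_five_halves {H : ℝ} (hH : H ≤ 5 / 2) (hB : (∀ η γ : ℝ, η ≠ 0 → |η| < 1 / 2 → riemannZeta (1 / 2 + η + γ * I) = 0 →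
      ∃ R : ℝ, 1 ≤ |γ| ∧
        doubleLogC0 (windowPlateau 1) |η| + Real.log (Real.log (|γ| + 2)) / (2 * |η|) ≤ H - 1 ∧
        1 ≤ R ∧ Real.exp (H - 1 + 1) ≤ R ^ 2 ∧
        (∀ ρ : ℂ, riemannZeta ρ = 0 → 0 ≤ ρ.re → ρ.re ≤ 1 → |ρ.im - γ| < R → ρ.re ≠ 1 / 2 →
            ρ = 1 / 2 + ↑|η| + γ * I ∨ ρ = 1 / 2 - ↑|η| + γ * I))) :
    _root_.RiemannHypothesis := by
  refine rh_of_visibleIsolated_of_upTo (T := 101) riemannHypothesisUpTo_hundredOne ?_ hB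
  have he : Real.exp 1 < 2.7182818286 := Real.exp_one_lt_d9
  have he0 : 0 < Real.exp 1 := Real.exp_pos 1
  set x := Real.exp (1 / 2) with hx
  have hx0 : 0 < x := Real.exp_pos _
  have hx2 : x ^ 2 = Real.exp 1 := by rw [hx, ← Real.exp_nat_mul]; norm_num
  have hx1 : x < 1.6488 := by
    by_contra h
    push Not at h
    have := mul_le_mul h h (by norm_num) hx0.le
    nlinarith
  have h32 : Real.exp (3 / 2) = x * Real.exp 1 := by
    rw [← hx2, hx, ← pow_succ', ← Real.exp_nat_mul]; norm_num
  have hxe : x * Real.exp 1 < 4.482 :=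
    lt_of_lt_of_le (mul_lt_mul'' hx1 he hx0.le he0.le) (by norm_num)
  have h1 : Real.exp (H - 1) ≤ 9 / 2 := by
    have : Real.exp (H - 1) ≤ Real.exp (3 / 2) := Real.exp_le_exp.2 (by linarith)
    linarith
  have h2 : Real.exp (Real.exp (H - 1)) ≤ Real.exp (9 / 2) := Real.exp_le_exp.2 h1
  have h92 : Real.exp (9 / 2) = Real.exp 1 ^ 4 * x := by
    have : Real.exp (9 / 2) = x ^ 9 := by rw [hx, ← Real.exp_nat_mul]; norm_num
    rw [this, show x ^ 9 = (x ^ 2) ^ 4 * x by ring, hx2]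
  have h4 : Real.exp 1 ^ 4 < (2.7182818286 : ℝ) ^ 4 := pow_lt_pow_left₀ he he0.le (by norm_num)
  have h5 : Real.exp 1 ^ 4 * x < (2.7182818286 : ℝ) ^ 4 * 1.6488 :=
    mul_lt_mul'' h4 hx1 (by positivity) hx0.le
  have h6 : (2.7182818286 : ℝ) ^ 4 * 1.6488 ≤ 101 + 2 := by norm_num
  linarith

/-- CONDITIONAL instance on the tree's named numerical fact `riemannHypothesisUpTo_platt_trudgian`
(`T = 3 000 175 332 800`, [PlattTrudgian2021, Thm 1]): for every window `H ≤ 4`, `B(H)` alone + Platt–Trudgian is RH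
(`e^{e^{3}} = 5.3·10⁸ ≤ T`); exact threshold `1 + log log(T+2) = 4.3579…`. So `FIN_W(H)` in `rh_of_finW_visibleIsolated`
carries weight only for windows `H > 4.3579…`. -/
theorem rh_of_visibleIsolated_of_le_four {H : ℝ} (hH : H ≤ 4)
    (hPT : Literature.NumberTheory.DiophantineGeometry.riemannHypothesisUpTo_platt_trudgian)
    (hB : (∀ η γ : ℝ, η ≠ 0 → |η| < 1 / 2 → riemannZeta (1 / 2 + η + γ * I) = 0 →
      ∃ R : ℝ, 1 ≤ |γ| ∧
        doubleLogC0 (windowPlateau 1) |η| + Real.log (Real.log (|γ| + 2)) / (2 * |η|) ≤ H - 1 ∧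
        1 ≤ R ∧ Real.exp (H - 1 + 1) ≤ R ^ 2 ∧
        (∀ ρ : ℂ, riemannZeta ρ = 0 → 0 ≤ ρ.re → ρ.re ≤ 1 → |ρ.im - γ| < R → ρ.re ≠ 1 / 2 →
            ρ = 1 / 2 + ↑|η| + γ * I ∨ ρ = 1 / 2 - ↑|η| + γ * I))) : _root_.RiemannHypothesis := by
  refine rh_of_visibleIsolated_of_upTo (T := 3000175332800) hPT ?_ hB
  have he : Real.exp 1 < 2.7182818286 := Real.exp_one_lt_d9
  have he0 : 0 < Real.exp 1 := Real.exp_pos 1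
  have h3 : Real.exp 3 = Real.exp 1 ^ 3 := by rw [← Real.exp_nat_mul]; norm_num
  have h3' : Real.exp 1 ^ 3 < (2.7182818286 : ℝ) ^ 3 := pow_lt_pow_left₀ he he0.le (by norm_num)
  have h1 : Real.exp (H - 1) ≤ 21 := by
    have : Real.exp (H - 1) ≤ Real.exp 3 := Real.exp_le_exp.2 (by linarith)
    have h5 : (2.7182818286 : ℝ) ^ 3 ≤ 21 := by norm_num
    linarith
  have h2 : Real.exp (Real.exp (H - 1)) ≤ Real.exp 21 := Real.exp_le_exp.2 h1
  have h21 : Real.exp 21 = Real.exp 1 ^ 21 := by rw [← Real.exp_nat_mul]; norm_num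
  have h7 : Real.exp 1 ^ 21 < (2.7182818286 : ℝ) ^ 21 := pow_lt_pow_left₀ he he0.le (by norm_num)
  have h8 : (2.7182818286 : ℝ) ^ 21 ≤ 3000175332800 + 2 := by norm_num
  linarith

end Summit.RiemannHypothesis.RiemannHypothesis.Theorems.Splittings.WeilNegRungs

end
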